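import Literature.MathematicalPhysics.QuantumFieldTheory.Borinsky2020.HeppSectorDecomposition
import HarnessLib

/-!
# Schultka 2018, Proposition 2.47 (after Fujishige): a generalized permutahedron `P(z) = 𝒢_z` is irreducible iff it has the maximal
dimension `|E| − 1`; consequently requirement R1 of Borinsky's Theorem 3 ("ℬ is (n−1)-dimensional") FOLLOWS from the rate condition
`r(A) = z_𝒜(A) − z_ℬ(A) > 0` of Theorem 27 / Corollary 24 — PROVED

independent recomputation; certified where stated, statistical where stated; no new-physics claim.

CITATION HEADER (venture `QEDPrecision`, cell `pub-qed`, track TROPICAL, LIT seat `pub-qed-trop-lit` gen 30; VALUE-FREE: statements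
about an arbitrary supermodular set function on a finite set — no integral is evaluated, nothing per graph or word, nothing of any Set V
family). Third file of the gen: the companion `EuclideanFeynmanQuadrature.lean` (same gen) had to keep R1 for the Feynman polytope
`ℬ = ½D NP_Ψ + ω(G) NP_Φ` as a HYPOTHESIS; this file removes that gap at the level of Theorem 27's generalized-permutahedron data.

SOURCES, VERBATIM. [Schultka2018] K. Schultka, "Toric geometry and regularization of Feynman integrals", arXiv:1806.01086 (HOME
`data/lit/sources/.cache/1806.01086/toricfeynman.tex`; numbering = `\newtheorem{thm}[section]` shared counter), §2 (l.1183–1193): "To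
z we associate the base polyhedron P(z) = {m ∈ ℝ^E | ⟨m, e^E⟩ = z(E), ⟨m, e^I⟩ ≥ z(I) for I ⊊ E}. We will call z *supermodular*, if
z(I) + z(J) ≤ z(I∩J) + z(I∪J), for all I, J ∈ 2^E." (= the companions' `gpPolytope z` / `Supermodular z`, Borinsky's Theorem 23
eq. (39)); (l.1260–1264): "For I ⊊ E define the restriction z|_I and contraction z/_I by z|_I(J) = z(J), J ⊆ I, z/_I(J) = z(J ∪ I) −
z(I), J ⊆ E∖I"; **Proposition 2.46** ([MR1095782 = Fujishige, *Submodular functions and optimization* (1991), Corollary 3.17];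
l.1291–1296): "The coordinates of the vertex m_𝓘 are given by (m_𝓘)_k = z(I_k) − z(I_{k−1})." (= Borinsky's Lemma 26 eq. (41),
the companions' `ftVertex`); (l.1298–1299): "Let us call a generalized permutahedron P(z) *irreducible*, if there is no decomposition
E = I ∐ J, such that z = z|_I + z|_J."; **Proposition 2.47** ([MR1095782, Thm. 3.38]; l.1301–1308): "For each generalized
permutahedron P(z) there is a unique decomposition E = ∐_{k=1}^{r} I_k such that the P(z|_{I_k}) are irreducible and z = Σ_{k=1}^{r}
z|_{I_k}. The polytope P(z) is irreducible if and only if it has maximal dimension |E| − 1."; **Proposition 4.29** (l.2711–2736, proof):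
"This domain is nonempty if and only if P_G has dimension |E_G| − 1". [Borinsky2020] M. Borinsky, "Tropical Monte Carlo quadrature
for Feynman integrals", Ann. Inst. Henri Poincaré D 10 (2023) 635–685 = arXiv:2008.12310v2 (HOME `data/lit/sources/.cache/2008.12310/
tropical.tex`, e-print counter), **Theorem 3** (l.321–324): "The integral in eq. (integral) is convergent if **R1** the denominator
polytope ℬ is (n−1)-dimensional, …"; **Remark 4** (l.333–337): "Because each of the {a_i} and {b_j} polynomials is homogeneous,
neither 𝒜 nor ℬ is full dimensional in ℝⁿ. The condition in eq. (homogeneous) … guarantees that 𝒜 and ℬ both lie in the same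
hyperplane 𝒜, ℬ ⊂ {v ∈ ℝⁿ : ⟨𝟙, v⟩ = ξ} … in which ℬ is required to be full-dimensional by requirement R1."; **Theorem 27**
(l.1063–1067): "If 𝒜 and ℬ are generalized permutahedra with associated boolean functions z_𝒜, z_ℬ : 2^{[n]} → ℝ which fulfill the
requirements R1 and R2 of Theorem 3, …"; Corollary 24 (l.1024–1033) and Lemma 26 (l.1045–1057) as typed in the companions
`GeneralizedPermutahedronVertex.lean` / `GeneralizedPermutahedronInterior.lean`. Fujishige's book itself is NOT held by the cell
(`lit books`: 0 rows; the references.bib key `Fujishige2005` is the 2nd edition, whose numbering is not verified here) — the theorem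
is cited THROUGH Schultka's printed attribution and PROVED below independently.

TYPING (one new definition, the rest is the companions' vocabulary `Supermodular`, `gpPolytope` = 𝒢_z = P(z), `weylChamber`,
`chainSet` = A^σ_k = I_k, `ftVertex` = w^{(σ,z)} = m_𝓘, `alongChain`; ground set `[m+1] = Fin (m + 1)` so that "|E| − 1" reads
`m` and "dimension" reads `Module.finrank ℝ (vectorSpan ℝ 𝒢_z)` — the convention of `ConvergenceTheorem.lean`'s R1 hypothesis
`Module.finrank ℝ (vectorSpan ℝ ℬ) = n`): **`IsIrreducibleGP z`** := "no decomposition E = I ∐ Iᶜ, both non-empty, with z(A) =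
z(A ∩ I) + z(A ∩ Iᶜ) for all A" (Schultka's sentence, with `z|_I + z|_J` read on `2^E` through `A ↦ (A ∩ I, A ∩ J)`).

PROVED (0 named facts). Part A: `add_compl_le` (`z(I) + z(E∖I) ≤ z(E)`), `eq_add_of_add_compl_eq` (a separator `z(I) + z(E∖I) =
z(E)` splits `z = z|_I + z|_{E∖I}`), **`isIrreducibleGP_iff_add_compl_lt`** (irreducible ⇔ `z(I) + z(E∖I) < z(E)` for all
non-empty proper `I`). Part B: `sum_eq_zero_of_mem_vectorSpan`, `sum_univ_eq_zero_of_mem_vectorSpan_gpPolytope` (Remark 4: `aff 𝒢_z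
∥ 𝟙^⊥`). Part C: `chainSet_revPerm_trans` (`A^{σ∘rev}_k = E ∖ A^σ_{m+1−k}`), `alongChain_ftVertex_revPerm_trans`,
**`inner_ftVertex_sub_rev_eq_sum`** (Abel summation: `⟨y, w^{(σ,z)} − w^{(σ∘rev,z)}⟩ = Σ_{j<m} (y_{σ(j+1)} − y_{σ(j)})·(z(E) −
z(A^σ_{j+1}) − z(E∖A^σ_{j+1}))`), **`eq_const_of_inner_ftVertex_sub_rev_eq_zero`** (for `y ∈ C_σ` and `z` without separator the
vanishing of that pairing forces `y` constant). Part D: **`finrank_vectorSpan_gpPolytope_eq`** (irreducible ⇒ `dim = m`),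
**`finrank_vectorSpan_gpPolytope_lt`** (a non-empty proper separator ⇒ `dim < m`), **`isIrreducibleGP_iff_finrank_eq`** (Proposition
2.47's second sentence, both directions), `finrank_vectorSpan_gpPolytope_le` (Remark 4: `dim ≤ m` always). Part E:
**`finrank_vectorSpan_gpPolytope_eq_of_rate`** — for supermodular `z_𝒜`, `z_ℬ` with `z_𝒜(∅) = z_ℬ(∅) = 0`, `z_𝒜(E) = z_ℬ(E)` and
`z_ℬ(A) < z_𝒜(A)` on non-empty proper `A` (Theorem 27's / Corollary 24's data, the companions' hypothesis format `hr`, `htop`),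
`dim 𝒢_{z_ℬ} = m`: REQUIREMENT R1 IS A CONSEQUENCE OF THE RATE CONDITION (`z_ℬ(I) + z_ℬ(E∖I) < z_𝒜(I) + z_𝒜(E∖I) ≤ z_𝒜(E) =
z_ℬ(E)`, so `z_ℬ` has no separator). Route: not Fujishige's lattice-theoretic proof (book not held) — a direct argument: a linear
functional `⟨y, ·⟩` vanishing on `vectorSpan 𝒢_z` takes equal values at the two vertices `w^{(σ,z)}`, `w^{(σ∘rev,z)}` of the sorting
permutation `σ` of `y` and of its reverse; Abel summation writes the difference as a non-negative combination of the separator defects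
`z(E) − z(A^σ_j) − z(E∖A^σ_j) > 0` with coefficients the increments of the sorted `y`, which must therefore vanish — `y ∈ ℝ𝟙`; with
`𝟙 ∉ vectorSpan 𝒢_z ⊂ 𝟙^⊥` this pins the dimension.

NOT typed / does NOT say: the first sentence of Proposition 2.47 (existence and uniqueness of the decomposition into irreducible
components, `dim P(z) = |E| − r`); Corollary 2.48 (facets of an irreducible `P(z)`), Proposition 2.49 (building sets); Schultka's
Proposition 4.17 (`P_G` irreducible ⇔ `G` s-irreducible, via 1VI components and kinematics) and Proposition 4.29's convergence
domain — for the Euclidean Feynman integrand the companion's sequel derives R1 from `r_G > 0` through Part E instead, which is all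
Theorem 27 needs; nothing about any implementation, word, or integrand.
(Filed by the pub-qed TROPICAL literature seat `pub-qed-trop-lit` gen 30; `tropical/lit/SOURCES.md` A36.)
-/

namespace Literature.MathematicalPhysics.QuantumFieldTheory.Borinsky2020

open Finset

variable {n : ℕ}

/-! ## Part A: irreducible boolean functions (Schultka's definition) and separators -/

/-- Schultka: "Let us call a generalized permutahedron `P(z)` *irreducible*, if there is no decomposition `E = I ∐ J`, such that
`z = z|_I + z|_J`" (restriction "`z|_I(J) = z(J), J ⊆ I`", read on `2^E` through `A ↦ A ∩ I`; both parts non-empty). Stated for the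
boolean function `z` of `𝒢_z = P(z)`. [cite: Schultka2018, §2 before Proposition 2.47 (toricfeynman.tex l.1260–1264, l.1298–1299)] -/
def IsIrreducibleGP (z : Finset (Fin n) → ℝ) : Prop :=
  ∀ I : Finset (Fin n), I.Nonempty → Iᶜ.Nonempty → ¬ ∀ A : Finset (Fin n), z A = z (A ∩ I) + z (A ∩ Iᶜ)

/-- For a supermodular `z` with `z(∅) = 0`: `z(I) + z(E∖I) ≤ z(E)` (supermodularity at the pair `I, E∖I`).
[cite: Schultka2018, §2 (toricfeynman.tex l.1190–1193); Borinsky2020, Theorem 23 (tex l.1017–1021)] -/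
theorem add_compl_le {z : Finset (Fin n) → ℝ} (hz : Supermodular z) (h0 : z ∅ = 0) (I : Finset (Fin n)) :
    z I + z Iᶜ ≤ z univ := by
  have h := hz I Iᶜ
  rwa [inter_compl, union_compl, h0, zero_add] at h

/-- A separator splits `z`: if `z(I) + z(E∖I) = z(E)` for a supermodular `z` with `z(∅) = 0`, then `z(A) = z(A ∩ I) + z(A∖I)` for
every `A` — the decomposition `z = z|_I + z|_{E∖I}` of Schultka's definition. [cite: Schultka2018, Proposition 2.47 (toricfeynman.tex
l.1301–1308), after Fujishige, *Submodular functions and optimization* (1991), Thm. 3.38] -/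
theorem eq_add_of_add_compl_eq {z : Finset (Fin n) → ℝ} (hz : Supermodular z) (h0 : z ∅ = 0) {I : Finset (Fin n)}
    (hI : z I + z Iᶜ = z univ) (A : Finset (Fin n)) : z A = z (A ∩ I) + z (A ∩ Iᶜ) := by
  apply le_antisymm
  · have h1 := hz A I
    have h2 := hz (A ∪ I) Iᶜ
    have e1 : (A ∪ I) ∩ Iᶜ = A ∩ Iᶜ := by
      ext i
      simp only [mem_inter, mem_union, mem_compl]
      tauto
    have e2 : (A ∪ I) ∪ Iᶜ = univ := by
      ext i
      simp only [mem_union, mem_compl, mem_univ, iff_true]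
      tauto
    rw [e1, e2] at h2
    linarith
  · have h3 := hz (A ∩ I) (A ∩ Iᶜ)
    have e3 : (A ∩ I) ∩ (A ∩ Iᶜ) = ∅ := by
      ext i
      simp only [mem_inter, mem_compl, Finset.notMem_empty, iff_false]
      tauto
    have e4 : (A ∩ I) ∪ (A ∩ Iᶜ) = A := by
      ext i
      simp only [mem_union, mem_inter, mem_compl]
      tauto
    rw [e3, e4, h0, zero_add] at h3
    exact h3

/-- **Irreducibility = no separator**: for a supermodular `z` with `z(∅) = 0`, `𝒢_z` is irreducible iff `z(I) + z(E∖I) < z(E)` for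
every non-empty proper `I`. [cite: Schultka2018, Proposition 2.47 (toricfeynman.tex l.1298–1308), after Fujishige (1991) Thm. 3.38] -/
theorem isIrreducibleGP_iff_add_compl_lt {z : Finset (Fin n) → ℝ} (hz : Supermodular z) (h0 : z ∅ = 0) :
    IsIrreducibleGP z ↔ ∀ I : Finset (Fin n), I.Nonempty → Iᶜ.Nonempty → z I + z Iᶜ < z univ := by
  constructor
  · intro h I hI hIc
    exact lt_of_le_of_ne (add_compl_le hz h0 I) fun heq => h I hI hIc (eq_add_of_add_compl_eq hz h0 heq)
  · intro h I hI hIc hdec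
    have hu := hdec univ
    rw [univ_inter, univ_inter] at hu
    exact (h I hI hIc).ne' hu

/-! ## Part B: `𝒢_z` lies in the hyperplane `⟨𝟙, v⟩ = z(E)` -/

/-- If `Σ_{i∈I} v_i = c` on `S`, then `Σ_{i∈I} u_i = 0` on the direction `vectorSpan S`. Plumbing (linear algebra).
[cite: Borinsky2020, Remark 4 (tex l.333–336: "𝒜, ℬ ⊂ {v : ⟨𝟙, v⟩ = ξ}")] -/
theorem sum_eq_zero_of_mem_vectorSpan {S : Set (Fin n → ℝ)} {I : Finset (Fin n)} {c : ℝ} (hS : ∀ v ∈ S, ∑ i ∈ I, v i = c)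
    {u : Fin n → ℝ} (hu : u ∈ vectorSpan ℝ S) : ∑ i ∈ I, u i = 0 := by
  rw [vectorSpan_def] at hu
  induction hu using Submodule.span_induction with
  | mem x hx =>
      obtain ⟨v, hv, v', hv', rfl⟩ := hx
      simp only [vsub_eq_sub, Pi.sub_apply, sum_sub_distrib, hS v hv, hS v' hv', sub_self]
  | zero => simp
  | add x y _ _ hx hy => simp [sum_add_distrib, hx, hy]
  | smul c x _ hx => simp [← mul_sum, hx]

/-- `𝒢_z ⊂ {v : ⟨𝟙, v⟩ = z(E)}`: every direction `u ∈ vectorSpan 𝒢_z` has `Σ_i u_i = 0` ("neither 𝒜 nor ℬ is full dimensional in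
ℝⁿ"). [cite: Borinsky2020, Remark 4 (tex l.333–336); Theorem 23 eq. (39)] -/
theorem sum_univ_eq_zero_of_mem_vectorSpan_gpPolytope {z : Finset (Fin n) → ℝ} {u : Fin n → ℝ}
    (hu : u ∈ vectorSpan ℝ (gpPolytope z)) : ∑ i, u i = 0 :=
  sum_eq_zero_of_mem_vectorSpan (I := univ) (fun _ hv => hv.1) hu

/-- Adjoining `𝟙` to a subspace of `𝟙^⊥` raises the dimension by one. Plumbing (linear algebra).
[cite: Borinsky2020, Remark 4 (tex l.333–336)] -/
private theorem finrank_sup_span_one {W : Submodule ℝ (Fin (n + 1) → ℝ)} (hW : ∀ u ∈ W, ∑ i, u i = 0) :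
    Module.finrank ℝ ↥(W ⊔ (ℝ ∙ (fun _ => (1 : ℝ)))) = Module.finrank ℝ W + 1 := by
  set one : Fin (n + 1) → ℝ := fun _ => 1 with hone
  have hne : one ≠ 0 := fun h => by simpa [hone] using congr_fun h 0
  have hinf : W ⊓ (ℝ ∙ one) = ⊥ := by
    rw [Submodule.eq_bot_iff]
    intro x hx
    obtain ⟨hxW, hx1⟩ := Submodule.mem_inf.1 hx
    obtain ⟨t, rfl⟩ := Submodule.mem_span_singleton.1 hx1
    have hs := hW _ hxW
    simp only [Pi.smul_apply, hone, smul_eq_mul, mul_one, sum_const, card_univ, Fintype.card_fin, nsmul_eq_mul] at hs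
    have ht : t = 0 := by
      rcases mul_eq_zero.1 hs with h | h
      · exact absurd h (by positivity)
      · exact h
    simp [ht]
  have h := Submodule.finrank_sup_add_finrank_inf_eq W (ℝ ∙ one)
  rw [hinf, finrank_bot, add_zero, finrank_span_singleton hne] at h
  exact h

/-! ## Part C: the chain read backwards; `⟨y, w^{(σ,z)} − w^{(σ∘rev,z)}⟩` by Abel summation -/

variable {m : ℕ}

/-- The reversed chain: for `ρ = σ ∘ rev` (`ρ(k) = σ(m − k)` on `Fin (m+1)`), `A^ρ_k = E ∖ A^σ_{m+1−k}`. Plumbing for chain sets.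
[cite: Borinsky2020, Lemma 26 (tex l.1049)] -/
theorem chainSet_revPerm_trans (σ : Equiv.Perm (Fin (m + 1))) {k : ℕ} (hk : k ≤ m + 1) :
    chainSet (Fin.revPerm.trans σ) k = (chainSet σ (m + 1 - k))ᶜ := by
  ext i
  simp only [mem_chainSet, mem_compl, Equiv.symm_trans_apply, Fin.revPerm_symm, Fin.revPerm_apply, Fin.val_rev, not_lt]
  have hi : ((σ.symm i : Fin (m + 1)) : ℕ) < m + 1 := (σ.symm i).2
  omega

/-- Reading `w^{(σ∘rev,z)}` along `σ`: `w^{(σ∘rev,z)}_{σ(k+1)} = z(E∖A^σ_k) − z(E∖A^σ_{k+1})` (0-indexed). Plumbing.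
[cite: Borinsky2020, Lemma 26 eq. (41) (tex l.1045–1049)] -/
theorem alongChain_ftVertex_revPerm_trans (z : Finset (Fin (m + 1)) → ℝ) (σ : Equiv.Perm (Fin (m + 1))) {k : ℕ}
    (hk : k < m + 1) :
    alongChain σ (ftVertex z (Fin.revPerm.trans σ)) k = z (chainSet σ k)ᶜ - z (chainSet σ (k + 1))ᶜ := by
  rw [alongChain_of_lt σ _ hk]
  have hσ : σ ⟨k, hk⟩ = (Fin.revPerm.trans σ) (Fin.rev ⟨k, hk⟩) := by
    simp [Fin.rev_rev]
  rw [hσ, ftVertex_apply, Fin.val_rev, chainSet_revPerm_trans σ (by omega), chainSet_revPerm_trans σ (by omega)]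
  have e1 : m + 1 - (m + 1 - (k + 1) + 1) = k := by omega
  have e2 : m + 1 - (m + 1 - (k + 1)) = k + 1 := by omega
  rw [e1, e2]

/-- **Abel summation of `⟨y, w^{(σ,z)} − w^{(σ∘rev,z)}⟩`**: with `Y_k = y_{σ(k)}` and the chain `A^σ_1 ⊂ ⋯ ⊂ A^σ_m` (0-indexed
`chainSet σ (j+1)`, `j < m`), `Σ_i y_i (w^{(σ,z)}_i − w^{(σ∘rev,z)}_i) = Σ_{j<m} (Y_{j+1} − Y_j)(z(E) − z(A^σ_{j+1}) − z(E∖A^σ_{j+1}))`.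
[cite: Borinsky2020, Lemma 26 eq. (41) (tex l.1045–1049); Schultka2018, Proposition 2.46 (vertex coordinates `z(I_k) − z(I_{k−1})`)] -/
theorem inner_ftVertex_sub_rev_eq_sum (z : Finset (Fin (m + 1)) → ℝ) (h0 : z ∅ = 0) (σ : Equiv.Perm (Fin (m + 1)))
    (y : Fin (m + 1) → ℝ) :
    ∑ i, y i * (ftVertex z σ i - ftVertex z (Fin.revPerm.trans σ) i) =
      ∑ j ∈ range m, (alongChain σ y (j + 1) - alongChain σ y j) *
        (z univ - z (chainSet σ (j + 1)) - z (chainSet σ (j + 1))ᶜ) := by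
  set ρ := Fin.revPerm.trans σ with hρ
  set S : ℕ → ℝ := fun k => z (chainSet σ k) + z (chainSet σ k)ᶜ with hS
  -- Step 1: read the sum along the chain of `σ`
  have h1 : ∑ i, y i * (ftVertex z σ i - ftVertex z ρ i) = ∑ k ∈ range (m + 1), alongChain σ y k * (S (k + 1) - S k) := by
    have h := sum_chainSet_eq_sum_range σ (fun i => y i * (ftVertex z σ i - ftVertex z ρ i)) (le_refl (m + 1))
    rw [chainSet_of_le σ le_rfl] at h
    rw [h]
    refine sum_congr rfl fun k hk => ?_
    have hk' : k < m + 1 := mem_range.1 hk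
    rw [alongChain_mul, show (fun i => ftVertex z σ i - ftVertex z ρ i) = fun i => ftVertex z σ i + (-1) * ftVertex z ρ i from
      funext fun i => by ring]
    rw [show alongChain σ (fun i => ftVertex z σ i + (-1) * ftVertex z ρ i) k =
        alongChain σ (ftVertex z σ) k + (-1) * alongChain σ (ftVertex z ρ) k by
      simp only [alongChain, hk', dif_pos]]
    rw [alongChain_ftVertex z σ hk', hρ, alongChain_ftVertex_revPerm_trans z σ hk', hS]
    ring
  -- Step 2: Abel summation
  have h2 := Finset.sum_range_by_parts (alongChain σ y) (fun k => S (k + 1) - S k) (m + 1)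
  simp only [smul_eq_mul, Finset.sum_range_sub, Nat.add_sub_cancel] at h2
  have hS0 : S 0 = z univ := by
    simp [hS, chainSet_zero, h0]
  have hSm : S (m + 1) = z univ := by
    simp [hS, chainSet_of_le σ le_rfl, h0]
  rw [h1, h2, hSm, hS0, sub_self, mul_zero, zero_sub, ← sum_neg_distrib]
  refine sum_congr rfl fun j _ => ?_
  simp only [hS]
  ring

/-- **A functional constant on `𝒢_z` is a multiple of `𝟙` when `z` is irreducible.** If `y ∈ C_σ` (sorted along `σ`) and
`⟨y, w^{(σ,z)}⟩ = ⟨y, w^{(σ∘rev,z)}⟩`, then `y` is constant: each Abel term `(Y_{j+1} − Y_j)(z(E) − z(A_j) − z(E∖A_j))` is `≥ 0`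
and the second factor is `> 0` by irreducibility. [cite: Schultka2018, Proposition 2.47 (toricfeynman.tex l.1301–1308), after Fujishige
(1991) Thm. 3.38; Borinsky2020, Lemma 26 (tex l.1045–1057)] -/
theorem eq_const_of_inner_ftVertex_sub_rev_eq_zero {z : Finset (Fin (m + 1)) → ℝ} (h0 : z ∅ = 0)
    (hirr : ∀ I : Finset (Fin (m + 1)), I.Nonempty → Iᶜ.Nonempty → z I + z Iᶜ < z univ)
    {σ : Equiv.Perm (Fin (m + 1))} {y : Fin (m + 1) → ℝ} (hy : y ∈ weylChamber σ)
    (h : ∑ i, y i * (ftVertex z σ i - ftVertex z (Fin.revPerm.trans σ) i) = 0) :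
    ∀ i, y i = y (σ 0) := by
  rw [inner_ftVertex_sub_rev_eq_sum z h0 σ y] at h
  have hΔ : ∀ j ∈ range m, 0 ≤ alongChain σ y (j + 1) - alongChain σ y j := by
    intro j hj
    have hj : j < m := mem_range.1 hj
    rw [alongChain_of_lt σ y (by omega : j + 1 < m + 1), alongChain_of_lt σ y (by omega : j < m + 1), sub_nonneg]
    exact hy _ _ (Fin.mk_le_mk.2 (Nat.le_succ j))
  have hpos : ∀ j ∈ range m, 0 < z univ - z (chainSet σ (j + 1)) - z (chainSet σ (j + 1))ᶜ := by
    intro j hj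
    have hj : j < m := mem_range.1 hj
    have hne : (chainSet σ (j + 1)).Nonempty := ⟨σ 0, apply_mem_chainSet.2 (Nat.succ_pos j)⟩
    have hce : (chainSet σ (j + 1))ᶜ.Nonempty :=
      ⟨σ (Fin.last m), by rw [mem_compl, apply_mem_chainSet, Fin.val_last]; omega⟩
    linarith [hirr _ hne hce]
  have hterm : ∀ j ∈ range m, (alongChain σ y (j + 1) - alongChain σ y j) *
      (z univ - z (chainSet σ (j + 1)) - z (chainSet σ (j + 1))ᶜ) = 0 :=
    (sum_eq_zero_iff_of_nonneg fun j hj => mul_nonneg (hΔ j hj) (hpos j hj).le).1 h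
  have hstep : ∀ j, j < m → alongChain σ y (j + 1) = alongChain σ y j := by
    intro j hj
    have := hterm j (mem_range.2 hj)
    rcases mul_eq_zero.1 this with h' | h'
    · exact sub_eq_zero.1 h'
    · exact absurd h' (hpos j (mem_range.2 hj)).ne'
  have hall : ∀ k, k < m + 1 → alongChain σ y k = alongChain σ y 0 := by
    intro k
    induction k with
    | zero => intro; rfl
    | succ k ih => intro hk; rw [hstep k (by omega), ih (by omega)]
  intro i
  have hi := hall (σ.symm i) (σ.symm i).2
  rw [alongChain_of_lt σ y (σ.symm i).2, alongChain_of_lt σ y (Nat.succ_pos m), Fin.eta, Equiv.apply_symm_apply] at hi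
  exact hi

/-! ## Part D: Schultka's Proposition 2.47 — irreducible iff dimension `|E| − 1` -/

/-- **Irreducible ⇒ full-dimensional in the hyperplane** (Fujishige's theorem, the direction R1 needs): for a supermodular `z` on
`2^{[m+1]}` with `z(∅) = 0` and `𝒢_z` irreducible, the direction of `aff 𝒢_z` has dimension `m` (= `|E| − 1`; "(n−1)-dimensional" in
the hyperplane `⟨𝟙, v⟩ = z(E)` of `ℝ^{m+1}`). Proof: a linear functional vanishing on `vectorSpan 𝒢_z` and on `𝟙` is constant on
`𝒢_z`, hence (Part C, comparing the vertices of a sorting permutation and of its reverse) a multiple of `⟨𝟙, ·⟩`, hence zero.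
[cite: Schultka2018, Proposition 2.47 (toricfeynman.tex l.1301–1308: "The polytope P(z) is irreducible if and only if it has maximal
dimension |E|−1"), after Fujishige, *Submodular functions and optimization* (1991), Thm. 3.38] -/
theorem finrank_vectorSpan_gpPolytope_eq {z : Finset (Fin (m + 1)) → ℝ} (hz : Supermodular z) (h0 : z ∅ = 0)
    (hirr : IsIrreducibleGP z) : Module.finrank ℝ (vectorSpan ℝ (gpPolytope z)) = m := by
  have hirr' := (isIrreducibleGP_iff_add_compl_lt hz h0).1 hirr
  set W := vectorSpan ℝ (gpPolytope z) with hW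
  have hWsum : ∀ u ∈ W, ∑ i, u i = 0 := fun u hu => sum_univ_eq_zero_of_mem_vectorSpan_gpPolytope hu
  have hsup : W ⊔ (ℝ ∙ (fun _ => (1 : ℝ))) = ⊤ := by
    by_contra hne
    obtain ⟨φ, hφ0, hle⟩ := Submodule.exists_le_ker_of_lt_top _ (lt_top_iff_ne_top.mpr hne)
    set y : Fin (m + 1) → ℝ := fun i => φ fun j => if i = j then 1 else 0 with hy
    have hφ : ∀ v : Fin (m + 1) → ℝ, φ v = ∑ i, y i * v i := fun v => by
      rw [LinearMap.pi_apply_eq_sum_univ φ v]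
      simp only [smul_eq_mul, hy, mul_comm]
    set σ := Tuple.sort y with hσ
    have hyσ : y ∈ weylChamber σ := mem_weylChamber_sort y
    have hvσ := ftVertex_mem_gpPolytope hz h0 σ
    have hvρ := ftVertex_mem_gpPolytope hz h0 (Fin.revPerm.trans σ)
    have hdiff : ftVertex z σ - ftVertex z (Fin.revPerm.trans σ) ∈ W := vsub_mem_vectorSpan ℝ hvσ hvρ
    have hker : φ (ftVertex z σ - ftVertex z (Fin.revPerm.trans σ)) = 0 :=
      LinearMap.mem_ker.1 (hle (Submodule.mem_sup_left hdiff))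
    rw [hφ] at hker
    simp only [Pi.sub_apply] at hker
    have hconst := eq_const_of_inner_ftVertex_sub_rev_eq_zero h0 hirr' hyσ hker
    have hone : φ (fun _ => (1 : ℝ)) = 0 :=
      LinearMap.mem_ker.1 (hle (Submodule.mem_sup_right (Submodule.mem_span_singleton_self _)))
    rw [hφ] at hone
    simp only [mul_one] at hone
    rw [sum_congr rfl fun i _ => hconst i, sum_const, card_univ, Fintype.card_fin, nsmul_eq_mul] at hone
    have hc : y (σ 0) = 0 := by
      rcases mul_eq_zero.1 hone with h | h
      · exact absurd h (by positivity)
      · exact h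
    refine hφ0 (LinearMap.ext fun v => ?_)
    rw [hφ v, LinearMap.zero_apply]
    exact sum_eq_zero fun i _ => by rw [hconst i, hc, zero_mul]
  have h := finrank_sup_span_one hWsum
  rw [hsup, finrank_top, Module.finrank_fin_fun] at h
  omega

/-- **Reducible ⇒ dimension drops**: if a non-empty proper `I` is a separator (`z(I) + z(E∖I) = z(E)`), then every `v ∈ 𝒢_z` has
`Σ_{i∈I} v_i = z(I)` and `dim aff 𝒢_z < m`. [cite: Schultka2018, Proposition 2.47 (toricfeynman.tex l.1301–1308), after Fujishige (1991)
Thm. 3.38; Proposition 2.44 (the face `F_{e^I} P(z) ≅ P(z|_I) × P(z/_I)`)] -/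
theorem finrank_vectorSpan_gpPolytope_lt {z : Finset (Fin (m + 1)) → ℝ} {I : Finset (Fin (m + 1))} (hI : I.Nonempty)
    (hIc : Iᶜ.Nonempty) (hsep : z I + z Iᶜ = z univ) : Module.finrank ℝ (vectorSpan ℝ (gpPolytope z)) < m := by
  set W := vectorSpan ℝ (gpPolytope z) with hW
  have hWsum : ∀ u ∈ W, ∑ i, u i = 0 := fun u hu => sum_univ_eq_zero_of_mem_vectorSpan_gpPolytope hu
  have htight : ∀ v ∈ gpPolytope z, ∑ i ∈ I, v i = z I := by
    intro v hv
    have h1 := hv.2 I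
    have h2 := hv.2 Iᶜ
    have h3 : ∑ i ∈ I, v i + ∑ i ∈ Iᶜ, v i = z univ := by rw [add_comm, sum_compl_add_sum, hv.1]
    linarith
  have hWI : ∀ u ∈ W, ∑ i ∈ I, u i = 0 := fun u hu => sum_eq_zero_of_mem_vectorSpan htight hu
  obtain ⟨a, ha⟩ := hI
  -- `e_a ∉ W ⊔ ℝ𝟙`
  have hnot : (Pi.single a 1 : Fin (m + 1) → ℝ) ∉ W ⊔ (ℝ ∙ (fun _ => (1 : ℝ))) := by
    intro hmem
    obtain ⟨u, hu, w, hw, huw⟩ := Submodule.mem_sup.1 hmem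
    obtain ⟨t, rfl⟩ := Submodule.mem_span_singleton.1 hw
    have eI := congr_arg (fun f : Fin (m + 1) → ℝ => ∑ i ∈ I, f i) huw
    have eU := congr_arg (fun f : Fin (m + 1) → ℝ => ∑ i, f i) huw
    simp only [Pi.add_apply, Pi.smul_apply, smul_eq_mul, mul_one, sum_add_distrib, hWI u hu, hWsum u hu, zero_add, sum_const,
      card_univ, Fintype.card_fin, nsmul_eq_mul, Pi.single_apply, sum_ite_eq', mem_univ, if_true, ha] at eI eU
    have hcard : (I.card : ℝ) < (m + 1 : ℕ) := by
      have : I.card < m + 1 := by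
        have h := Finset.card_lt_univ_of_notMem (s := I) (Classical.choose_spec hIc |> fun h => (mem_compl.1 h))
        simpa using h
      exact_mod_cast this
    have ht : t ≠ 0 := fun h0 => by simp [h0] at eI
    have : (I.card : ℝ) * t = (m + 1 : ℕ) * t := by rw [eI, eU]
    exact absurd (mul_right_cancel₀ ht this) hcard.ne
  have hlt : W ⊔ (ℝ ∙ (fun _ => (1 : ℝ))) < ⊤ := lt_top_iff_ne_top.2 fun htop => hnot (htop ▸ Submodule.mem_top)
  have h1 := Submodule.finrank_lt_finrank_of_lt hlt
  rw [finrank_top, Module.finrank_fin_fun, finrank_sup_span_one hWsum] at h1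
  omega

/-- **Schultka's Proposition 2.47** (after [Fujishige 1991, Thm. 3.38]): "The polytope `P(z)` is irreducible if and only if it has
maximal dimension `|E| − 1`" — for supermodular `z : 2^{[m+1]} → ℝ` with `z(∅) = 0`, with dimension read as `finrank (vectorSpan 𝒢_z)`
in `ℝ^{m+1}`. [cite: Schultka2018, Proposition 2.47 (toricfeynman.tex l.1301–1308)] -/
theorem isIrreducibleGP_iff_finrank_eq {z : Finset (Fin (m + 1)) → ℝ} (hz : Supermodular z) (h0 : z ∅ = 0) :
    IsIrreducibleGP z ↔ Module.finrank ℝ (vectorSpan ℝ (gpPolytope z)) = m := by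
  refine ⟨finrank_vectorSpan_gpPolytope_eq hz h0, fun h => (isIrreducibleGP_iff_add_compl_lt hz h0).2 fun I hI hIc => ?_⟩
  exact lt_of_le_of_ne (add_compl_le hz h0 I) fun heq => (finrank_vectorSpan_gpPolytope_lt hI hIc heq).ne h

/-- The dimension never exceeds `|E| − 1` ("neither 𝒜 nor ℬ is full dimensional in ℝⁿ").
[cite: Borinsky2020, Remark 4 (tex l.333–336)] -/
theorem finrank_vectorSpan_gpPolytope_le (z : Finset (Fin (m + 1)) → ℝ) :
    Module.finrank ℝ (vectorSpan ℝ (gpPolytope z)) ≤ m := by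
  set W := vectorSpan ℝ (gpPolytope z) with hW
  have hWsum : ∀ u ∈ W, ∑ i, u i = 0 := fun u hu => sum_univ_eq_zero_of_mem_vectorSpan_gpPolytope hu
  have h1 := Submodule.finrank_le (W ⊔ (ℝ ∙ (fun _ => (1 : ℝ))))
  rw [Module.finrank_fin_fun, finrank_sup_span_one hWsum] at h1
  omega

/-! ## Part E: R1 from the rate condition of Theorem 27 -/

/-- **Requirement R1 follows from the GP data of Theorem 27.** If `z_𝒜`, `z_ℬ` are supermodular with `z_𝒜(∅) = z_ℬ(∅) = 0`,
`z_𝒜(E) = z_ℬ(E)` and `r(A) = z_𝒜(A) − z_ℬ(A) > 0` for every non-empty proper `A` ("which fulfill the requirements R1 and R2 of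
Theorem 3" / Corollary 24's hypothesis), then `z_ℬ` has no separator — `z_ℬ(I) + z_ℬ(E∖I) < z_𝒜(I) + z_𝒜(E∖I) ≤ z_𝒜(E) = z_ℬ(E)` — so
`ℬ = 𝒢_{z_ℬ}` is `(n−1)`-dimensional: R1 of Theorem 3 HOLDS and need not be assumed separately. (Equivalently, Schultka's Prop. 4.29:
the convergence domain is non-empty only for irreducible polytopes.) [cite: Borinsky2020, Theorem 3 R1 (tex l.322–324), Theorem 27
(l.1063–1072), Corollary 24 (l.1024–1033); Schultka2018, Proposition 2.47, Proposition 4.29 (toricfeynman.tex l.2711–2736)] -/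
theorem finrank_vectorSpan_gpPolytope_eq_of_rate {zA zB : Finset (Fin (m + 1)) → ℝ} (hA : Supermodular zA) (h0A : zA ∅ = 0)
    (hB : Supermodular zB) (h0B : zB ∅ = 0)
    (hr : ∀ A : Finset (Fin (m + 1)), A.Nonempty → A ≠ univ → zB A < zA A) (htop : zA univ = zB univ) :
    Module.finrank ℝ (vectorSpan ℝ (gpPolytope zB)) = m := by
  refine finrank_vectorSpan_gpPolytope_eq hB h0B ((isIrreducibleGP_iff_add_compl_lt hB h0B).2 fun I hI hIc => ?_)
  have hI' : I ≠ univ := fun h => by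
    rw [h, compl_univ] at hIc
    exact Finset.not_nonempty_empty hIc
  have hIc' : Iᶜ ≠ univ := fun h => by
    rw [compl_eq_univ_iff] at h
    rw [h] at hI
    exact Finset.not_nonempty_empty hI
  calc zB I + zB Iᶜ < zA I + zA Iᶜ := add_lt_add (hr I hI hI') (hr Iᶜ hIc hIc')
    _ ≤ zA univ := add_compl_le hA h0A I
    _ = zB univ := htop

end Literature.MathematicalPhysics.QuantumFieldTheory.Borinsky2020
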